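import Summits.QuantumFields.BalabanUV.Beta.SpineRootedStepN
import Summits.QuantumFields.BalabanUV.Beta.VhSliceReflectionScaled
import Summits.QuantumFields.BalabanUV.Beta.StepLambdaReflection

/-!
# (Sr-conj) AT EVERY LEVEL `j` FOR THE NATIVE STEP STENCIL, MODULO THE VALUE-FUNCTION LAW: if the field–field block of the third-jet
# summand `e3NAtOf j` reflects with the contact `c · conjV 𝕄 (diagK ctGen)` against a bordered-shape kernel `𝕄`, then the whole step
# stencil `SstepNAt ρ_c cE cVH cΛ j` satisfies EXACTLY the socket hSrC with `C j α κ′ u := (cVH·wVH j / (s·Lc^{d+1})) • diagK (ctGen d α Lc κ′ u)`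
# (β sub-cell, row BETA-an2, gen 14; NOTE X-an2-45 §3 / (R45-4); the level-`j` twin of `S0NReflection.S0NAt_bref_of_wilsonLaw`)

HONEST FRAMING (cell charter, verbatim): «discharging BetaPertH makes Balaban's UV stability UNCONDITIONAL — a real
constructive-QFT result; it is NOT the continuum limit and NOT the Clay problem.»  DERIVED cell leaf (pub-balaban β sub-cell, lane
an2 gen 14); no statement of Bałaban's papers is typed here, no `[cite:]` tag, no `Prop` fact; it instantiates no binder of the
β-function wall by itself.  The kernel `𝕄` (bordered shape: border `= s ·` that of `bhKAt ρ_c Lc`, multiplier block `0`) and the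
value-function law `hE3ff` (free constant `c`) are explicit HYPOTHESES; nothing is asserted about the binder `𝕄_j` or about `e3NAtOf`.
NOT `BetaPertH`; NOT continuum; NOT Clay.

## What is here ([folklore] bookkeeping over `SpineRootedStepN`, `VhSliceReflectionScaled`, `StepLambdaReflection`)

* `SstepNAt_apply3` (the three summands entrywise), `e3NAtOf_inl_inr` / `_inr_inl` / `_inr_inr` (the third-jet summand lives on the
  field–field block: `mmRead` vanishes elsewhere);
* **`SstepNAt_bref_of_e3Law`**: HYPOTHESES (i) `𝕄` of bordered shape with scale `s ≠ 0` (`hfm`, `hmf`, `hmm`), (ii) `hE3ff`: for every axis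
  `α`, jet bond `(κ′, u)` and field–field entry,
  `e3NAtOf … j κ′ (bref α κ′ u) x z (inl a) (inl b) = ε_{κ′}·s_a·s_b·(e3NAtOf … j κ′ u (r x) (r z) (inl a) (inl b) + c·conjV 𝕄 (diagK (ctGen d α Lc κ′ u)) (r x) (r z) (inl a) (inl b))`,
  (iii) ONE normalisation `hc : cE·wE j·c = cVH·wVH j / (s·Lc^{d+1})`.  CONCLUSION: for every `α κ′ u`,
  `SstepNAt d Lc ρ_c cE cVH cΛ j κ′ (bref α κ′ u) = reflSign α κ′ • refK (Φ Lc α) (SstepNAt … j κ′ u + conjV 𝕄 ((cVH·wVH j / (s·Lc^{d+1})) • diagK (ctGen d α Lc κ′ u)))`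
  — the hypothesis hSrC of `SpineRooted.axisReflectionCovariant_flipK_TbalOf_JsBalBmNAtOf_ctrC` at level `j + 1 ↦ SstepNAt (j+1)` (and at
  any `j`), against whichever binder `𝕄_j` of that shape is supplied (an4-g33: `[[T_j, −M^{d+2}𝒬ᵀ],[M^{d+2}𝒬, 0]]`, `s = M^{d+2}`).
READING (asserted nowhere): the ff block of the contact is `𝕄_ff(x,z)·coeff·([x = u ∧ a = κ′] − [z = u ∧ b = κ′])·[κ′ = α]` — the `T_j`-window
same-bond letter the value-function summand must produce (the level-`j` Wilson law).  All declarations `[folklore]`; axioms standard.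
Provenance: b2b-balaban β sub-cell, unit beta-an2 gen 14, 2026-08-20 (v1); no existing file touched.
-/

open Finset
open scoped BigOperators
open Literature.MathematicalPhysics.QuantumFieldTheory
open Literature.MathematicalPhysics.QuantumFieldTheory.Balaban1983to89
open Literature.MathematicalPhysics.QuantumFieldTheory.Balaban1983to89.Beta
open ExpKernelCalculus (MKer comp)
open AveragingContoursRooted (ctr ctrOff)
open AveragingHessianKernels (packVH packVH_inl_inl)
open AveragingHessianKernelsRooted (vhSAt hessFFAt)
open PolarizationSign (reflSign)
open KernelReflection (LegMap refK refK_apply)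
open ResolventReflection (bref Φ Φ_r_inl Φ_r_inr Φ_s_inl Φ_s_inr)
open OneStepResolventKernel (Fib KInv)
open OneStepKernelFamily (KInvStep)
open InterLevelTransport (SLam)
open BalabanStepJetsSucc (mmRead E2 lamCoeffK wE wVH wΛ)
open Summit.QuantumFields.BalabanUV.Beta.ChartConjugation (conjV)
open Summit.QuantumFields.BalabanUV.Beta.BorderedHessian (bhKAt diagK ctGen)

noncomputable section

namespace Summit.QuantumFields.BalabanUV.Beta.SpineRooted

variable {d : ℕ} {Lc : ℕ} [NeZero Lc]

/-! ## §1 Entries of the step stencil and of its third-jet summand -/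

/-- [folklore] The three summands of the step stencil, entrywise. -/
theorem SstepNAt_apply3 (ρ : Fin (d + 1) → ℤ) (cE cVH cΛ : ℝ) (j : ℕ) (κ' : Fin (d + 1)) (w x z : Fin (d + 1) → ℤ) (a b : Fib d) :
    SstepNAt d Lc ρ cE cVH cΛ j κ' w x z a b =
      (cE * wE d Lc j) * e3NAtOf d Lc ρ cE cVH cΛ j κ' w x z a b +
        ((cVH * wVH d Lc j) • vhSAt ρ d Lc rfl κ' w) x z a b +
        ((cΛ * wΛ d Lc j) • SLam Lc (lamCoeffK (KInvStep (d := d) Lc j) (E2 d Lc j) Lc) (fun μ y => hessFFAt ρ Lc μ y) κ' w) x z a b := by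
  simp only [SstepNAt, Pi.add_apply, Pi.smul_apply, smul_eq_mul]

/-- [folklore] The third-jet summand has no field–multiplier block. -/
theorem e3NAtOf_inl_inr (ρ : Fin (d + 1) → ℤ) (cE cVH cΛ : ℝ) (j : ℕ) (κ' : Fin (d + 1)) (w x z : Fin (d + 1) → ℤ)
    (β μ : Fin (d + 1)) : e3NAtOf d Lc ρ cE cVH cΛ j κ' w x z (Sum.inl β) (Sum.inr μ) = 0 := by
  show -(0 : ℝ) = 0
  exact neg_zero

/-- [folklore] The third-jet summand has no multiplier–field block. -/
theorem e3NAtOf_inr_inl (ρ : Fin (d + 1) → ℤ) (cE cVH cΛ : ℝ) (j : ℕ) (κ' : Fin (d + 1)) (w x z : Fin (d + 1) → ℤ)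
    (μ β : Fin (d + 1)) : e3NAtOf d Lc ρ cE cVH cΛ j κ' w x z (Sum.inr μ) (Sum.inl β) = 0 := by
  show -(0 : ℝ) = 0
  exact neg_zero

/-- [folklore] The third-jet summand has no multiplier–multiplier block. -/
theorem e3NAtOf_inr_inr (ρ : Fin (d + 1) → ℤ) (cE cVH cΛ : ℝ) (j : ℕ) (κ' : Fin (d + 1)) (w x z : Fin (d + 1) → ℤ)
    (μ μ' : Fin (d + 1)) : e3NAtOf d Lc ρ cE cVH cΛ j κ' w x z (Sum.inr μ) (Sum.inr μ') = 0 := by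
  show -(0 : ℝ) = 0
  exact neg_zero

omit [NeZero Lc] in
/-- [folklore] The vh summand has no field–field block. -/
theorem smul_vhSAt_inl_inl (ρ : Fin (d + 1) → ℤ) (c : ℝ) (κ' : Fin (d + 1)) (w x z : Fin (d + 1) → ℤ) (β β' : Fin (d + 1)) :
    (c • vhSAt ρ d Lc rfl κ' w) x z (Sum.inl β) (Sum.inl β') = 0 := by
  simp only [Pi.smul_apply, smul_eq_mul, AveragingHessianKernelsRooted.vhSAt, packVH_inl_inl, mul_zero]

/-! ## §2 The law -/

/-- [folklore] **(Sr-conj) AT LEVEL `j` FOR THE NATIVE STEP STENCIL, MODULO THE VALUE-FUNCTION LAW WITH CONTACT.**  See the module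
docstring: bordered-shape `𝕄` (scale `s ≠ 0`), the ff-block law `hE3ff` of `e3NAtOf j` with contact constant `c`, and
`cE·wE j·c = cVH·wVH j / (s·Lc^{d+1})` give the socket hSrC for `SstepNAt ρ_c cE cVH cΛ j` with the contact
`(cVH·wVH j / (s·Lc^{d+1})) • diagK (ctGen d α Lc κ′ u)`. -/
theorem SstepNAt_bref_of_e3Law (hLc : Odd Lc) (cE cVH cΛ : ℝ) (j : ℕ) {s : ℝ} (hs : s ≠ 0) {𝕄 : MKer (d + 1) (Fib d)}
    (hfm : ∀ x z β μ, 𝕄 x z (Sum.inl β) (Sum.inr μ) = s * bhKAt d (ctr (d + 1) Lc) Lc x z (Sum.inl β) (Sum.inr μ))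
    (hmf : ∀ x z μ β, 𝕄 x z (Sum.inr μ) (Sum.inl β) = s * bhKAt d (ctr (d + 1) Lc) Lc x z (Sum.inr μ) (Sum.inl β))
    (hmm : ∀ x z μ μ', 𝕄 x z (Sum.inr μ) (Sum.inr μ') = 0) (c : ℝ)
    (hc : cE * wE d Lc j * c = cVH * wVH d Lc j / (s * (Lc : ℝ) ^ (d + 1)))
    (hE3ff : ∀ (α κ' : Fin (d + 1)) (u x z : Fin (d + 1) → ℤ) (a b : Fin (d + 1)),
      e3NAtOf d Lc (ctr (d + 1) Lc) cE cVH cΛ j κ' (bref α κ' u) x z (Sum.inl a) (Sum.inl b) =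
        reflSign α κ' * ((Φ Lc α).s (Sum.inl a) * (Φ Lc α).s (Sum.inl b) *
          (e3NAtOf d Lc (ctr (d + 1) Lc) cE cVH cΛ j κ' u ((Φ Lc α).r (Sum.inl a) x) ((Φ Lc α).r (Sum.inl b) z) (Sum.inl a) (Sum.inl b) +
            c * conjV 𝕄 (diagK (ctGen d α Lc κ' u)) ((Φ Lc α).r (Sum.inl a) x) ((Φ Lc α).r (Sum.inl b) z) (Sum.inl a) (Sum.inl b))))
    (α κ' : Fin (d + 1)) (u : Fin (d + 1) → ℤ) :
    SstepNAt d Lc (ctr (d + 1) Lc) cE cVH cΛ j κ' (bref α κ' u) =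
      reflSign α κ' • refK (Φ Lc α) (SstepNAt d Lc (ctr (d + 1) Lc) cE cVH cΛ j κ' u +
        conjV 𝕄 ((cVH * wVH d Lc j / (s * (Lc : ℝ) ^ (d + 1))) • diagK (ctGen d α Lc κ' u))) := by
  -- the Λ summand: pure sign, entrywise
  have hΛ := smul_SLam_step_reflect (d := d) hLc cΛ j α κ' u
  funext x z a b
  have hΛx := congrFun (congrFun (congrFun (congrFun hΛ x) z) a) b
  simp only [Pi.smul_apply, smul_eq_mul, refK_apply] at hΛx
  rw [SstepNAt_apply3]
  simp only [Pi.smul_apply, Pi.add_apply, smul_eq_mul, refK_apply, conjV_smul_right, SstepNAt_apply3]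
  rcases a with β | μ <;> rcases b with β' | μ'
  · -- field–field: e3 carries the contact, vh vanishes, Λ pure sign
    rw [hE3ff α κ' u x z β β', hΛx]
    have hv0 := smul_vhSAt_inl_inl (Lc := Lc) (ctr (d + 1) Lc) (cVH * wVH d Lc j) κ' (bref α κ' u) x z β β'
    have hv1 := smul_vhSAt_inl_inl (Lc := Lc) (ctr (d + 1) Lc) (cVH * wVH d Lc j) κ' u ((Φ Lc α).r (Sum.inl β) x)
      ((Φ Lc α).r (Sum.inl β') z) β β'
    simp only [Pi.smul_apply, smul_eq_mul] at hv0 hv1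
    rw [hv0, hv1]
    have hc' : cVH * wVH d Lc j / (s * (Lc : ℝ) ^ (d + 1)) = cE * wE d Lc j * c := hc.symm
    rw [hc']
    ring
  · -- field–multiplier: vh carries the contact, e3 vanishes
    have hv := smul_vhSAt_bref_inl_inr hLc (cVH * wVH d Lc j) hs hfm α κ' u x z β μ'
    simp only [Pi.smul_apply, Pi.add_apply, smul_eq_mul, refK_apply, conjV_smul_right] at hv
    rw [e3NAtOf_inl_inr, e3NAtOf_inl_inr, hv, hΛx]
    ring
  · have hv := smul_vhSAt_bref_inr_inl hLc (cVH * wVH d Lc j) hs hmf α κ' u x z μ β'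
    simp only [Pi.smul_apply, Pi.add_apply, smul_eq_mul, refK_apply, conjV_smul_right] at hv
    rw [e3NAtOf_inr_inl, e3NAtOf_inr_inl, hv, hΛx]
    ring
  · have hv := smul_vhSAt_bref_inr_inr hLc (cVH * wVH d Lc j) (s := s) hmm α κ' u x z μ μ'
    simp only [Pi.smul_apply, Pi.add_apply, smul_eq_mul, refK_apply, conjV_smul_right] at hv
    rw [e3NAtOf_inr_inr, e3NAtOf_inr_inr, hv, hΛx]
    ring

end Summit.QuantumFields.BalabanUV.Beta.SpineRooted

end
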